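import Summits.HodgeConjecture.CorCM.RationalExteriorAlgebra
import Summits.HodgeConjecture.CorCM.Model.TopTraceUnit
import Literature.AlgebraicGeometry.Motives.AbelianVarietyExterior
import Literature.AlgebraicGeometry.HodgeTheory.ComplexOrientationFamily
import Literature.AlgebraicTopology.SingularHomology.PoincareDualityCorollaries
import HarnessLib

/-!
# COR-CM model layer, row M22 `Fact_algDuality`, kernel K-a step (3): a Fourier-type sum
# `z ↦ Σ_c τ(z ∪ x_c) • y_c` on the rational cohomology of a complex abelian variety is bijective

Cell `pub-hodgecm2` (COR-CM), seat b29 (second seat on sub-kernel K-a of row M22 of `BINDER-OWNERS.md`;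
K-a = model-1's transcription of the tree's abstract Fourier-type operator
`Motives.WeilCohomology.fourierOp` (`Literature/AlgebraicGeometry/Motives/AbelianVarietyExterior.lean`) to the
Betti carriers of the Picard–CM model).  HONEST FRAMING: a statement of LINEAR ALGEBRA on the real carriers
`Hᵏ(A(ℂ); ℚ)`; nothing about algebraic cycles is asserted and no case of the Hodge conjecture is proved.

For a complex abelian variety `A` of dimension `g`, two bases `b`, `y` of `H¹(A(ℂ); ℚ)` indexed by `Fin N`
(so `N = 2g`), complementary degrees `j + i = 2g`, and an injective linear functional `τ` on the top line
`H^{2g}(A(ℂ); ℚ)` (e.g. the light trace `BettiUniverse.tr`, `tr_top_injective`), every linear map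
`D : Hʲ(A(ℂ); ℚ) → Hⁱ(A(ℂ); ℚ)` of the shape

  `D z = Σ_{c : Fin i → Fin N} τ(z ∪ m_i(b ∘ c)) • m_i(y ∘ c)`   (`m_i` = the iterated cup product `cupPowOne`)

is INJECTIVE, hence BIJECTIVE (`dim Hʲ = (2g choose j) = (2g choose i) = dim Hⁱ`).  This is the tree's
`WeilCohomology.fourierOp_injective` / `fourierOp_bijective` (there for an abstract Weil cohomology `W` and the
polar basis `y = polBasis`) transcribed to singular cohomology, with the second basis made GENERIC: the proof
regroups the sum over the images of the injective tuples `c` (`WeilCohomology.exists_sum_eq_sum_powersetCard`,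
the products being alternating), uses the linear independence of the products `m_i(y ∘ e_s)` over the
`i`-subsets `s` (`linearIndependent_cupPowOne_of_linearIndependent`, from `H•(A(ℂ); ℚ) = ⋀• H¹`,
`hasExteriorCohomologyH1_rat`), the spanning of `Hⁱ` by the products `m_i(b ∘ e_s)` (same source), and
Poincaré duality over `ℚ` for the closed oriented manifold `A(ℂ)` (`isPerfPair_cupPairing_of_field_holds`).

Main declarations (namespace `Summit.HodgeConjecture.CorCM.Model`, all def-free):
* `isPerfPair_cupPairing_rat`, `eq_zero_of_forall_cupProduct_eq_zero` — Poincaré duality for `X(ℂ)` with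
  rational coefficients and its left non-degeneracy form;
* `cupPowOne_comp_perm`, `cupPowOne_eq_zero_of_not_injective'`, `span_range_cupPowOne_basis` — the iterated cup
  product is alternating; products of basis vectors over the `i`-subsets span `Hⁱ(A(ℂ); ℚ)`;
* `injective_of_eq_fourierSum`, `bijective_of_eq_fourierSum` — the theorem, for any injective `τ` on the top
  line (degrees `j + i = m`, `m = 2 dim A`);
* `bijective_of_eq_fourierSum_tr`, `bijective_of_eq_fourierSum_cup_tr` — the instances for the light trace
  `BettiUniverse.tr` with `bettiCup` resp. `BettiUniverse.cup`.

## References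
* [Kleiman1968AlgebraicCycles] S. Kleiman, *Algebraic cycles and the Weil conjectures* (1968), §2 Appendix 2A
  (2A9–2A11: the Fourier-type correspondences of an abelian variety).
* [Lieberman1968] D. Lieberman, *Numerical and homological equivalence of algebraic cycles on Hodge manifolds*,
  Amer. J. Math. 90 (1968) 366–374.
* [MumfordAV1970] D. Mumford, *Abelian Varieties* (1970), §1 (4).
* [HatcherAT2002] A. Hatcher, *Algebraic Topology* (2002), §3.2 Thm. 3.11, §3.3 Prop. 3.38.
-/

noncomputable section

open CategoryTheory
open Literature.AlgebraicTopology.SingularHomology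
open Literature.AlgebraicGeometry Literature.AlgebraicGeometry.Motives Literature.AlgebraicGeometry.HodgeTheory
open Set.powersetCard

namespace Summit.HodgeConjecture.CorCM.Model

/-! ### Poincaré duality for `X(ℂ)` with rational coefficients -/

section PoincareDuality

variable {n : ℕ} {X : SchemeOver ℂ}

/-- **Poincaré duality over `ℚ` for `X(ℂ)`**: for `X` smooth projective of dimension `n`, the cup product
pairing `Hᵃ(X(ℂ); ℚ) × Hᵈ(X(ℂ); ℚ) → ℚ`, `(u, v) ↦ ⟨u ∪ v, [X(ℂ)]⟩` (`a + d = 2n`, rational complex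
orientation), is perfect (Hatcher Prop. 3.38 for the closed oriented manifold `X(ℂ)`: the tree's
`isPerfPair_cupPairing_of_field_holds`). [cite: HatcherAT2002, §3.3 Prop. 3.38] -/
theorem isPerfPair_cupPairing_rat (hX : IsSmoothProjective n X) {a d : ℕ} (had : a + d = 2 * n) :
    (cupPairing (complexOrientationRat hX) had).IsPerfPair := by
  letI := hX.chartedSpace
  haveI := Motives.ComplexPoints.compactSpace_of_isSmoothProjective hX
  haveI := Motives.ComplexPoints.t2Space_of_isSmoothProjective hX
  exact isPerfPair_cupPairing_of_field_holds

/-- **Left non-degeneracy of the cup product**: a class `z ∈ Hᵃ(X(ℂ); ℚ)` with `z ∪ x = 0` for every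
`x ∈ Hᵈ(X(ℂ); ℚ)` (`a + d = 2 dim X`) vanishes. [cite: HatcherAT2002, §3.3 Prop. 3.38] -/
theorem eq_zero_of_forall_cupProduct_eq_zero (hX : IsSmoothProjective n X) {a d : ℕ} (had : a + d = 2 * n)
    (z : bettiCohomology X a) (hz : ∀ x : bettiCohomology X d, cupProduct had z x = 0) : z = 0 := by
  haveI := isPerfPair_cupPairing_rat hX had
  apply (LinearMap.IsPerfPair.bijective_left (cupPairing (complexOrientationRat hX) had)).1
  rw [map_zero]
  ext x
  rw [cupPairing_apply, hz, LinearMap.zero_apply, LinearMap.map_zero₂]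

end PoincareDuality

/-! ### The iterated cup product of degree-one classes: alternation, spanning by products of basis vectors -/

section Products

variable (A : AbelianVariety ℂ)

/-- `m_i(v ∘ σ) = sign(σ) • m_i(v)` for a permutation `σ` of the factors (the iterated cup product of
degree-one classes is alternating, `cupPowOneAlt`). [cite: HatcherAT2002, §3.2 Thm. 3.11] -/
theorem cupPowOne_comp_perm (i : ℕ) (v : Fin i → bettiCohomology A.X 1) (σ : Equiv.Perm (Fin i)) :
    cupPowOne ℚ (ComplexPoints A.X) i (v ∘ σ) = Equiv.Perm.sign σ • cupPowOne ℚ (ComplexPoints A.X) i v := by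
  have h := (cupPowOneAlt ℚ (ComplexPoints A.X) i).map_perm v σ
  simpa only [cupPowOneAlt_apply] using h

/-- `m_i(v) = 0` when the family `v` of degree-one classes is not injective (alternation).
[cite: HatcherAT2002, §3.2 Thm. 3.11] -/
theorem cupPowOne_eq_zero_of_not_injective' (i : ℕ) (v : Fin i → bettiCohomology A.X 1)
    (hv : ¬ Function.Injective v) : cupPowOne ℚ (ComplexPoints A.X) i v = 0 := by
  have h := (cupPowOneAlt ℚ (ComplexPoints A.X) i).map_eq_zero_of_not_injective v hv
  simpa only [cupPowOneAlt_apply] using h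

/-- **The products `m_i(b_{s₁}, …, b_{s_i})` over the `i`-element subsets `s` span `Hⁱ(A(ℂ); ℚ)`** for a
basis `b` of `H¹(A(ℂ); ℚ)` (`Hⁱ = ⋀ⁱ H¹`, `hasExteriorCohomologyH1_rat`; Mathlib
`exteriorPower.ιMulti_family_span_of_span`). [cite: MumfordAV1970, §1 (4)] -/
theorem span_range_cupPowOne_basis {I : Type*} [LinearOrder I] (b : Module.Basis I ℚ (bettiCohomology A.X 1))
    (i : ℕ) :
    Submodule.span ℚ (Set.range fun s : Set.powersetCard I i ↦
      cupPowOne ℚ (ComplexPoints A.X) i (b ∘ ofFinEmbEquiv.symm s)) = ⊤ := by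
  have h1 : (Set.range fun s : Set.powersetCard I i ↦ cupPowOne ℚ (ComplexPoints A.X) i (b ∘ ofFinEmbEquiv.symm s)) =
      wedgeToCup ℚ (ComplexPoints A.X) i '' Set.range (exteriorPower.ιMulti_family ℚ i b) := by
    rw [← Set.range_comp]
    congr 1
    funext s
    simp only [Function.comp_apply, exteriorPower.ιMulti_family, wedgeToCup_ιMulti]
  rw [h1, ← Submodule.map_span, exteriorPower.ιMulti_family_span_of_span ℚ b.span_eq, Submodule.map_top,
    LinearMap.range_eq_top]
  exact (hasExteriorCohomologyH1_rat A i).2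

/-- **The products `m_i(y_{s₁}, …, y_{s_i})` over the `i`-element subsets `s` are linearly independent** in
`Hⁱ(A(ℂ); ℚ)` for a basis `y` of `H¹(A(ℂ); ℚ)` (`linearIndependent_cupPowOne_of_linearIndependent`).
[cite: MumfordAV1970, §1 (4)] -/
theorem linearIndependent_cupPowOne_basis {I : Type*} [LinearOrder I]
    (y : Module.Basis I ℚ (bettiCohomology A.X 1)) (i : ℕ) :
    LinearIndependent ℚ (fun s : Set.powersetCard I i ↦
      cupPowOne ℚ (ComplexPoints A.X) i (y ∘ ofFinEmbEquiv.symm s)) := by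
  have h := linearIndependent_cupPowOne_of_linearIndependent A i y.linearIndependent
  convert h using 1
  funext s
  simp only [exteriorPower.ιMulti_family, wedgeToCup_ιMulti]

end Products

/-! ### The Fourier-type sum is bijective -/

section Fourier

variable (A : AbelianVariety ℂ)

/-- **Injectivity of a Fourier-type sum.**  Let `b`, `y` be bases of `H¹(A(ℂ); ℚ)` indexed by `Fin N`,
`j + i = m = 2 dim A`, `τ` an injective linear functional on `Hᵐ(A(ℂ); ℚ)`, and `D : Hʲ → Hⁱ` a linear map with
`D z = Σ_{c : Fin i → Fin N} τ(z ∪ m_i(b ∘ c)) • m_i(y ∘ c)`.  Then `D` is injective: regrouping the sum by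
the images `s` of the injective tuples `c` (the products are alternating) gives
`D z = Σ_s N_s τ(z ∪ m_i(b ∘ e_s)) • m_i(y ∘ e_s)` with `N_s ≠ 0`; the `m_i(y ∘ e_s)` are linearly
independent, so every `τ(z ∪ m_i(b ∘ e_s))` vanishes; `τ` is injective and the `m_i(b ∘ e_s)` span `Hⁱ`, so
`z ∪ x = 0` for all `x ∈ Hⁱ`, whence `z = 0` by Poincaré duality.  (The tree's abstract
`WeilCohomology.fourierOp_injective`, transcribed; `y` generic.) [cite: Kleiman1968AlgebraicCycles, §2 Appendix 2A] -/
theorem injective_of_eq_fourierSum {N i j m : ℕ} (b y : Module.Basis (Fin N) ℚ (bettiCohomology A.X 1))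
    (hm : j + i = m) (hm₂ : m = 2 * A.dim) (τ : bettiCohomology A.X m →ₗ[ℚ] ℚ) (hτ : Function.Injective τ)
    (D : bettiCohomology A.X j →ₗ[ℚ] bettiCohomology A.X i)
    (hD : ∀ z, D z = ∑ c : Fin i → Fin N,
      τ (bettiCup hm z (cupPowOne ℚ (ComplexPoints A.X) i (fun p ↦ b (c p)))) •
        cupPowOne ℚ (ComplexPoints A.X) i (fun p ↦ y (c p))) :
    Function.Injective D := by
  classical
  subst hm₂
  have hA : IsSmoothProjective A.dim A.X := AbelianVariety.isSmoothProjective_holds (A := A)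
  rw [← LinearMap.ker_eq_bot, LinearMap.ker_eq_bot']
  intro z hz
  -- regroup the sum over the images of the injective tuples
  let F : (Fin i → Fin N) → bettiCohomology A.X i := fun c ↦
    τ (bettiCup hm z (cupPowOne ℚ (ComplexPoints A.X) i (fun p ↦ b (c p)))) •
      cupPowOne ℚ (ComplexPoints A.X) i (fun p ↦ y (c p))
  have h0 : ∀ c, ¬ Function.Injective c → F c = 0 := by
    intro c hc
    have h : cupPowOne ℚ (ComplexPoints A.X) i (fun p ↦ b (c p)) = 0 :=
      cupPowOne_eq_zero_of_not_injective' A i _ fun h ↦ hc (Function.Injective.of_comp (f := b) h)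
    simp only [F]
    rw [h, map_zero, map_zero, zero_smul]
  have hperm : ∀ (c : Fin i → Fin N) (σ : Equiv.Perm (Fin i)), F (c ∘ σ) = F c := by
    intro c σ
    have hx : cupPowOne ℚ (ComplexPoints A.X) i (fun p ↦ b ((c ∘ σ) p)) =
        Equiv.Perm.sign σ • cupPowOne ℚ (ComplexPoints A.X) i (fun p ↦ b (c p)) :=
      cupPowOne_comp_perm A i (fun p ↦ b (c p)) σ
    have hy : cupPowOne ℚ (ComplexPoints A.X) i (fun p ↦ y ((c ∘ σ) p)) =
        Equiv.Perm.sign σ • cupPowOne ℚ (ComplexPoints A.X) i (fun p ↦ y (c p)) :=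
      cupPowOne_comp_perm A i (fun p ↦ y (c p)) σ
    simp only [F]
    rw [hx, hy, Units.smul_def, Units.smul_def, map_zsmul, map_zsmul, smul_assoc,
      smul_comm _ ((Equiv.Perm.sign σ : ℤ)), ← mul_smul, ← Units.val_mul, Int.units_mul_self,
      Units.val_one, one_smul]
  obtain ⟨Ns, hN, hsum⟩ := WeilCohomology.exists_sum_eq_sum_powersetCard F h0 hperm
  simp only [F] at hsum
  rw [hD, hsum] at hz
  -- the coefficients vanish
  have hli := linearIndependent_cupPowOne_basis A y i
  have hz' : ∑ s : Set.powersetCard (Fin N) i,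
      ((Ns s : ℚ) * τ (bettiCup hm z (cupPowOne ℚ (ComplexPoints A.X) i (b ∘ ofFinEmbEquiv.symm s)))) •
        cupPowOne ℚ (ComplexPoints A.X) i (y ∘ ofFinEmbEquiv.symm s) = 0 := by
    rw [← hz]
    refine Finset.sum_congr rfl fun s _ ↦ ?_
    rw [mul_smul, Nat.cast_smul_eq_nsmul]
    rfl
  have hcoef := Fintype.linearIndependent_iff.mp hli _ hz'
  have key : ∀ s : Set.powersetCard (Fin N) i,
      bettiCup hm z (cupPowOne ℚ (ComplexPoints A.X) i (b ∘ ofFinEmbEquiv.symm s)) = 0 := fun s ↦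
    hτ (by
      rw [map_zero]
      exact (mul_eq_zero.mp (hcoef s)).resolve_left (Nat.cast_ne_zero.mpr (hN s)))
  -- the products of the basis vectors span `Hⁱ`, so `z ∪ x = 0` for every `x`
  have hker : LinearMap.ker (bettiCup hm z) = ⊤ := by
    rw [eq_top_iff, ← span_range_cupPowOne_basis A b i, Submodule.span_le]
    rintro _ ⟨s, rfl⟩
    exact key s
  have hzx : ∀ x : bettiCohomology A.X i, cupProduct hm z x = 0 := fun x ↦
    LinearMap.mem_ker.mp (hker ▸ Submodule.mem_top (x := x))
  -- Poincaré duality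
  exact eq_zero_of_forall_cupProduct_eq_zero hA hm z hzx

/-- **Bijectivity of a Fourier-type sum** (`injective_of_eq_fourierSum` and the dimension count
`dim Hʲ(A(ℂ); ℚ) = (2g choose j) = (2g choose i) = dim Hⁱ(A(ℂ); ℚ)` for `j + i = 2g`).
[cite: Kleiman1968AlgebraicCycles, §2 Appendix 2A] [cite: MumfordAV1970, §1 (4)] -/
theorem bijective_of_eq_fourierSum {N i j m : ℕ} (b y : Module.Basis (Fin N) ℚ (bettiCohomology A.X 1))
    (hm : j + i = m) (hm₂ : m = 2 * A.dim) (τ : bettiCohomology A.X m →ₗ[ℚ] ℚ) (hτ : Function.Injective τ)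
    (D : bettiCohomology A.X j →ₗ[ℚ] bettiCohomology A.X i)
    (hD : ∀ z, D z = ∑ c : Fin i → Fin N,
      τ (bettiCup hm z (cupPowOne ℚ (ComplexPoints A.X) i (fun p ↦ b (c p)))) •
        cupPowOne ℚ (ComplexPoints A.X) i (fun p ↦ y (c p))) :
    Function.Bijective D := by
  have hA : IsSmoothProjective A.dim A.X := AbelianVariety.isSmoothProjective_holds (A := A)
  haveI := BettiUniverse.finite hA j
  haveI := BettiUniverse.finite hA i
  have hinj := injective_of_eq_fourierSum A b y hm hm₂ τ hτ D hD
  have hfin : Module.finrank ℚ (bettiCohomology A.X j) = Module.finrank ℚ (bettiCohomology A.X i) := by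
    rw [finrank_bettiCohomology_abelianVariety, finrank_bettiCohomology_abelianVariety]
    exact Nat.choose_symm_of_eq_add (by omega)
  exact ⟨hinj, (LinearMap.injective_iff_surjective_of_finrank_eq_finrank hfin).mp hinj⟩

/-- **Bijectivity of a Fourier-type sum, light-trace form**: `D z = Σ_c tr(z ∪ m_i(b ∘ c)) • m_i(y ∘ c)` with
`∪ = bettiCup (hij : j + i = 2 dim A)` and `tr = BettiUniverse.tr hA (2 dim A)` (injective on the top line,
`tr_top_injective`) is bijective `Hʲ(A(ℂ); ℚ) → Hⁱ(A(ℂ); ℚ)`, for ANY two bases `b`, `y` of `H¹(A(ℂ); ℚ)`.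
[cite: Kleiman1968AlgebraicCycles, §2 Appendix 2A] -/
theorem bijective_of_eq_fourierSum_tr (hA : IsSmoothProjective A.dim A.X) {N i j : ℕ}
    (b y : Module.Basis (Fin N) ℚ (bettiCohomology A.X 1)) (hij : j + i = 2 * A.dim)
    (D : bettiCohomology A.X j →ₗ[ℚ] bettiCohomology A.X i)
    (hD : ∀ z, D z = ∑ c : Fin i → Fin N,
      BettiUniverse.tr hA (2 * A.dim) (bettiCup hij z (cupPowOne ℚ (ComplexPoints A.X) i (fun p ↦ b (c p)))) •
        cupPowOne ℚ (ComplexPoints A.X) i (fun p ↦ y (c p))) :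
    Function.Bijective D :=
  bijective_of_eq_fourierSum A b y hij rfl (BettiUniverse.tr hA (2 * A.dim)) (tr_top_injective hA) D hD

/-- **Bijectivity of a Fourier-type sum, `BettiUniverse.cup` form**: the same with the cup product
`BettiUniverse.cup A.X j i` (degree `j + i` on the nose) and the light trace `BettiUniverse.tr hA (j + i)`.
[cite: Kleiman1968AlgebraicCycles, §2 Appendix 2A] -/
theorem bijective_of_eq_fourierSum_cup_tr (hA : IsSmoothProjective A.dim A.X) {N i j : ℕ}
    (b y : Module.Basis (Fin N) ℚ (bettiCohomology A.X 1)) (hij : j + i = 2 * A.dim)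
    (D : bettiCohomology A.X j →ₗ[ℚ] bettiCohomology A.X i)
    (hD : ∀ z, D z = ∑ c : Fin i → Fin N,
      BettiUniverse.tr hA (j + i) (BettiUniverse.cup A.X j i z (cupPowOne ℚ (ComplexPoints A.X) i (fun p ↦ b (c p)))) •
        cupPowOne ℚ (ComplexPoints A.X) i (fun p ↦ y (c p))) :
    Function.Bijective D := by
  have hτ : Function.Injective (BettiUniverse.tr hA (j + i)) := by
    rw [hij]
    exact tr_top_injective hA
  exact bijective_of_eq_fourierSum A b y rfl hij (BettiUniverse.tr hA (j + i)) hτ D hD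

end Fourier

end Summit.HodgeConjecture.CorCM.Model

end
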